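import Mathlib
import HarnessLib
import Literature.Analysis.FluidPDE.TypeIAncientMild
import Literature.Analysis.FluidPDE.KNSSWindowLipschitz
import Summits.NavierStokesRegularity.NavierStokesRegularity.Theorems.SqueezeCycleExtremalElementExistsRescale
import Summits.NavierStokesRegularity.NavierStokesRegularity.Theorems.SqueezeCycleExtremalElementExistsRegularity

/-!
# Crux `ForcedSymmetry` (stmt-NavierStokesRegularity-4052), line `blow-down-census`:
# blow-down limits do not depend on the centre

Route `SymmetryModuliCount`, sub-problem `NavierStokesRegularity`.  Lead file (gen 2, seat `-1`) for the X-strength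
stub `stub_blowDownLimitSelfSimilar`.

For `v` in the Type-I KNSS-mild ancient class `A_C` (`IsTypeIAncientMild C v`) the blow-down families
`c ↦ c v(t₁ + c² s, x₁ + c y)` at two centres `(t₁, x₁)`, `(t₁', x₁')` with `t₁, t₁' ≤ 0` differ, at every fixed
`(s, y)` with `s < 0`, by `o(1)` as `c → ∞` (`tendsto_blowDown_sub_blowDown`): both are values of ONE zoom
`w_c = c v(c² ·, x₁ + c ·) ∈ A_C` at points `(s + t₁/c², y)` and `(s + t₁'/c², y + (x₁' − x₁)/c)`, and the class
`A_C` has uniform gradient and time-Lipschitz bounds on compact time windows (KNSS 2009 §4,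
`exists_norm_iteratedFDeriv_le_of_typeI`, `exists_lipschitz_time_of_typeI`).  Hence subsequential and full blow-down
LIMITS are independent of the centre (`tendsto_blowDown_centre`, `tendsto_blowDown_centre_seq`): the set of blow-down
limits `Ω(v)` is a canonical object attached to `v` (its asymptotic cone at `t = −∞`), and the card's
`UniqueBlowDown` is one statement per element, not per centre.
-/

noncomputable section

-- the summit and its single problem share the name (D-0017 nested layout)
set_option linter.dupNamespace false

open Set Function Filter Topology Metric
open Literature.Analysis.FluidPDE
open Summit.NavierStokesRegularity.NavierStokesRegularity.Theorems

namespace Summit.NavierStokesRegularity.NavierStokesRegularity.Theorems.SymmetryModuliCountForcedSymmetry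

/-- **Blow-down families at two centres are asymptotically equal.**  For `v ∈ A_C`, centres `(t₁, x₁)`, `(t₁', x₁')`
with `t₁, t₁' ≤ 0`, and a fixed point `(s, y)` with `s < 0`:
`c v(t₁' + c² s, x₁' + c y) − c v(t₁ + c² s, x₁ + c y) → 0` as `c → ∞`.  (Both terms are values of the zoom
`w_c = c v(c²·, x₁ + c·) ∈ A_C` at the nearby points `(s + t₁/c², y)`, `(s + t₁'/c², y + (x₁' − x₁)/c)`; the
class-uniform gradient bound and time-Lipschitz bound on a window around `s` give
`≤ K‖x₁' − x₁‖/c + L|t₁' − t₁|/c²`.) [cite: KochNadirashviliSereginSverak2009, §4 (4.10)–(4.11) (arXiv:0709.3599v1 p. 8)] -/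
theorem tendsto_blowDown_sub_blowDown {C : ℝ} {v : ℝ → EuclideanSpace ℝ (Fin 3) → EuclideanSpace ℝ (Fin 3)}
    (hv : IsTypeIAncientMild C v) {t₁ t₁' : ℝ} (ht₁ : t₁ ≤ 0) (ht₁' : t₁' ≤ 0)
    (x₁ x₁' : EuclideanSpace ℝ (Fin 3)) {s : ℝ} (hs : s < 0) (y : EuclideanSpace ℝ (Fin 3)) :
    Tendsto (fun c : ℝ => c • v (t₁' + c ^ 2 * s) (x₁' + c • y) - c • v (t₁ + c ^ 2 * s) (x₁ + c • y))
      atTop (𝓝 0) := by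
  -- the window around `s` and the class-uniform constants
  set a : ℝ := s + t₁ + t₁' - 1 with ha
  set b : ℝ := s / 2 with hb
  have hab : a < b := by rw [ha, hb]; linarith
  have hb0 : b < 0 := by rw [hb]; linarith
  obtain ⟨K, hK⟩ := exists_norm_iteratedFDeriv_le_of_typeI C 1 hab hb0 one_half_pos
  obtain ⟨L, hL0, hL⟩ := exists_lipschitz_time_of_typeI C 0 hab hb0 one_half_pos
  -- the bound, for `c ≥ 1`
  have hbound : ∀ c : ℝ, 1 ≤ c →
      ‖c • v (t₁' + c ^ 2 * s) (x₁' + c • y) - c • v (t₁ + c ^ 2 * s) (x₁ + c • y)‖ ≤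
        K * ‖x₁' - x₁‖ * c⁻¹ + L * |t₁' - t₁| * (c ^ 2)⁻¹ := by
    intro c hc
    have hc0 : 0 < c := one_pos.trans_le hc
    have hc2 : 0 < c ^ 2 := by positivity
    have hc21 : 1 ≤ c ^ 2 := by nlinarith
    -- the zoom `w = c v(c² ·, x₁ + c ·) ∈ A_C`
    set w : ℝ → EuclideanSpace ℝ (Fin 3) → EuclideanSpace ℝ (Fin 3) := c • stPull (c ^ 2) c 0 x₁ v with hw
    have hwA : IsTypeIAncientMild C w := isTypeIAncientMild_zoom hv hc0 x₁
    -- the two shifted times lie in the window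
    set σ : ℝ := s + t₁ / c ^ 2 with hσ
    set σ' : ℝ := s + t₁' / c ^ 2 with hσ'
    have hdiv : ∀ {τ : ℝ}, τ ≤ 0 → τ ≤ τ / c ^ 2 := fun {τ} hτ => by
      rw [le_div_iff₀ hc2]; nlinarith
    have hdiv' : ∀ {τ : ℝ}, τ ≤ 0 → τ / c ^ 2 ≤ 0 := fun {τ} hτ => div_nonpos_of_nonpos_of_nonneg hτ hc2.le
    have hσw : σ ∈ Ico (a + 1 / 2) b := by
      refine ⟨?_, ?_⟩
      · rw [ha, hσ]; linarith [hdiv ht₁]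
      · rw [hb, hσ]; linarith [hdiv' ht₁]
    have hσ'w : σ' ∈ Ico (a + 1 / 2) b := by
      refine ⟨?_, ?_⟩
      · rw [ha, hσ']; linarith [hdiv ht₁']
      · rw [hb, hσ']; linarith [hdiv' ht₁']
    have hσ0 : σ < 0 := hσw.2.trans hb0
    have hσ'0 : σ' < 0 := hσ'w.2.trans hb0
    -- the two terms as values of `w`
    have e1 : c • v (t₁ + c ^ 2 * s) (x₁ + c • y) = w σ y := by
      simp only [hw, smul_stPull_apply, zero_add, hσ]
      congr 2
      field_simp
      ring
    have e2 : c • v (t₁' + c ^ 2 * s) (x₁' + c • y) = w σ' (y + c⁻¹ • (x₁' - x₁)) := by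
      simp only [hw, smul_stPull_apply, zero_add, hσ']
      congr 2
      · field_simp
        ring
      · rw [smul_add, smul_smul, mul_inv_cancel₀ hc0.ne', one_smul]
        abel
    rw [e1, e2]
    -- space increment: mean value with the class gradient bound at the time `σ'`
    have hgrad : ∀ z : EuclideanSpace ℝ (Fin 3), ‖fderiv ℝ (w σ') z‖ ≤ K := fun z => by
      have h := hK hwA.continuousOn_uncurry (fun t ht => hwA.isWeaklyDivFree ht)
        (fun s' t' hst ht' x => hwA.mild_eq_heatExtension hst ht' x) hwA.hasTypeITimeDecay σ' hσ'w z
      rwa [norm_iteratedFDeriv_one] at h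
    have hdiff : ∀ z ∈ (univ : Set (EuclideanSpace ℝ (Fin 3))), DifferentiableAt ℝ (w σ') z := fun z _ =>
      ((hwA.contDiff_slice hσ'0).differentiable (by simp)).differentiableAt
    have hspace : ‖w σ' (y + c⁻¹ • (x₁' - x₁)) - w σ' y‖ ≤ K * ‖x₁' - x₁‖ * c⁻¹ := by
      have h := convex_univ.norm_image_sub_le_of_norm_fderiv_le hdiff (fun z _ => hgrad z) (mem_univ y)
        (mem_univ (y + c⁻¹ • (x₁' - x₁)))
      rw [add_sub_cancel_left, norm_smul, Real.norm_of_nonneg (inv_nonneg.2 hc0.le)] at h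
      linarith [h]
    -- time increment: the class time-Lipschitz bound between `σ` and `σ'`
    have htime : ‖w σ' y - w σ y‖ ≤ L * |t₁' - t₁| * (c ^ 2)⁻¹ := by
      have h := hL hwA.continuousOn_uncurry (fun t ht => hwA.isWeaklyDivFree ht)
        (fun s' t' hst ht' x => hwA.mild_eq_heatExtension hst ht' x) hwA.hasTypeITimeDecay σ hσw σ' hσ'w y
      rw [norm_iteratedFDeriv_zero_sub] at h
      have e : |σ' - σ| = |t₁' - t₁| * (c ^ 2)⁻¹ := by
        rw [hσ, hσ', show s + t₁' / c ^ 2 - (s + t₁ / c ^ 2) = (t₁' - t₁) * (c ^ 2)⁻¹ by ring, abs_mul,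
          abs_of_pos (inv_pos.2 hc2)]
      rw [e, ← mul_assoc] at h
      exact h
    calc ‖w σ' (y + c⁻¹ • (x₁' - x₁)) - w σ y‖
        = ‖(w σ' (y + c⁻¹ • (x₁' - x₁)) - w σ' y) + (w σ' y - w σ y)‖ := by rw [sub_add_sub_cancel]
      _ ≤ ‖w σ' (y + c⁻¹ • (x₁' - x₁)) - w σ' y‖ + ‖w σ' y - w σ y‖ := norm_add_le _ _
      _ ≤ K * ‖x₁' - x₁‖ * c⁻¹ + L * |t₁' - t₁| * (c ^ 2)⁻¹ := add_le_add hspace htime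
  -- the majorant tends to `0`
  have hmaj : Tendsto (fun c : ℝ => K * ‖x₁' - x₁‖ * c⁻¹ + L * |t₁' - t₁| * (c ^ 2)⁻¹) atTop (𝓝 0) := by
    have h1 : Tendsto (fun c : ℝ => K * ‖x₁' - x₁‖ * c⁻¹) atTop (𝓝 0) := by
      simpa using tendsto_inv_atTop_zero.const_mul (K * ‖x₁' - x₁‖)
    have h2 : Tendsto (fun c : ℝ => L * |t₁' - t₁| * (c ^ 2)⁻¹) atTop (𝓝 0) := by
      have h := (tendsto_pow_atTop (α := ℝ) two_ne_zero).inv_tendsto_atTop.const_mul (L * |t₁' - t₁|)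
      simpa using h
    simpa using h1.add h2
  refine tendsto_zero_iff_norm_tendsto_zero.2 (squeeze_zero' (Eventually.of_forall fun c => norm_nonneg _) ?_ hmaj)
  filter_upwards [eventually_ge_atTop (1 : ℝ)] with c hc
  exact hbound c hc

/-- **Blow-down limits are independent of the centre (full families).**  If the family at `(t₁, x₁)` converges at
`(s, y)`, `s < 0`, then the family at any other centre `(t₁', x₁')` (`t₁, t₁' ≤ 0`) converges there to the same
value. [cite: KochNadirashviliSereginSverak2009, §4 (4.10)–(4.11)] -/
theorem tendsto_blowDown_centre {C : ℝ} {v : ℝ → EuclideanSpace ℝ (Fin 3) → EuclideanSpace ℝ (Fin 3)}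
    (hv : IsTypeIAncientMild C v) {t₁ t₁' : ℝ} (ht₁ : t₁ ≤ 0) (ht₁' : t₁' ≤ 0)
    (x₁ x₁' : EuclideanSpace ℝ (Fin 3)) {s : ℝ} (hs : s < 0) (y L₀ : EuclideanSpace ℝ (Fin 3))
    (h : Tendsto (fun c : ℝ => c • v (t₁ + c ^ 2 * s) (x₁ + c • y)) atTop (𝓝 L₀)) :
    Tendsto (fun c : ℝ => c • v (t₁' + c ^ 2 * s) (x₁' + c • y)) atTop (𝓝 L₀) := by
  have key := (tendsto_blowDown_sub_blowDown hv ht₁ ht₁' x₁ x₁' hs y).add h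
  rw [zero_add] at key
  exact key.congr fun c => by simp only [sub_add_cancel]

/-- **Blow-down limits are independent of the centre (sequences).**  Along any scales `c_k > 0`, `c_k → ∞`: if the
blow-downs at `(t₁, x₁)` converge at `(s, y)`, `s < 0`, so do those at `(t₁', x₁')` (`t₁, t₁' ≤ 0`), to the same
value — so every subsequential blow-down limit at one centre is a blow-down limit at every centre, along the same
scales. [cite: KochNadirashviliSereginSverak2009, §4 (4.10)–(4.11)] -/
theorem tendsto_blowDown_centre_seq {C : ℝ} {v : ℝ → EuclideanSpace ℝ (Fin 3) → EuclideanSpace ℝ (Fin 3)}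
    (hv : IsTypeIAncientMild C v) {t₁ t₁' : ℝ} (ht₁ : t₁ ≤ 0) (ht₁' : t₁' ≤ 0)
    (x₁ x₁' : EuclideanSpace ℝ (Fin 3)) {c : ℕ → ℝ} (hctop : Tendsto c atTop atTop)
    {s : ℝ} (hs : s < 0) (y L₀ : EuclideanSpace ℝ (Fin 3))
    (h : Tendsto (fun k => c k • v (t₁ + c k ^ 2 * s) (x₁ + c k • y)) atTop (𝓝 L₀)) :
    Tendsto (fun k => c k • v (t₁' + c k ^ 2 * s) (x₁' + c k • y)) atTop (𝓝 L₀) := by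
  have key := ((tendsto_blowDown_sub_blowDown hv ht₁ ht₁' x₁ x₁' hs y).comp hctop).add h
  rw [zero_add] at key
  exact key.congr fun k => by simp only [comp_apply, sub_add_cancel]

end Summit.NavierStokesRegularity.NavierStokesRegularity.Theorems.SymmetryModuliCountForcedSymmetry

end
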